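import Literature.NumberTheory.DiophantineGeometry.AbcWave0
import HarnessLib

/-!
# abc for triples with `16 ∣ abc` implies abc for all triples

Topic `Literature/NumberTheory/DiophantineGeometry` (family `abc`). Theorems only. An elementary
reduction used with the Frey curve: Serre's normalisation of the Frey–Hellegouarch curve
`y² = x(x − A)(x + B)` (`A ≡ −1 (mod 4)`, `16 ∣ B`, semistable, conductor `rad(ABC)`; Serre 1987
§4.1, Diamond–Kramer 1995, Bombieri–Gubler Ex. 12.5.10) is available only for abc triples with
`16 ∣ abc` (`Literature.NumberTheory.EllipticCurves.exists_arrangement`). Routes that state the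
modular degree conjecture for SEMISTABLE curves (`ABC/QuaternionicDegree`,
`ABC/IsogenyGlueCongruence`) therefore reach the abc inequality first for such triples; this file
supplies the passage to all triples:

* `abcLe_of_abcLe_sixteen_dvd` — if for every `ε > 0` there is `C` with `c ≤ C rad(abc)^{1+ε}` for
  all abc triples with `16 ∣ abc`, then the same holds for all abc triples.

Proof (folklore; the device of passing to `(u⁸, v⁸ − u⁸, v⁸)`): if `16 ∤ abc`, let `u < v` be the
two odd members of `{a, b, c}` and `w` the even one (the case `a = b = 1` aside). Then
`(u⁸, v⁸ − u⁸, v⁸)` is an abc triple with `32 ∣ v⁸ − u⁸`, and since `w ∈ {v − u, v + u}` divides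
`v⁸ − u⁸ = (v − u)(v + u)(v² + u²)(v⁴ + u⁴)` with cofactor `≤ 8v⁷`,
`rad(u⁸ (v⁸ − u⁸) v⁸) ≤ 8 v⁷ rad(uvw) = 8 v⁷ rad(abc)`. The hypothesis with exponent `1 + ε'`
gives `v⁸ ≤ C (8 v⁷ rad(abc))^{1+ε'}`, i.e. `v^{1−7ε'} ≤ C 8^{1+ε'} rad(abc)^{1+ε'}`, and
`c ≤ 2v`; with `ε' = ε/(8 + 7ε)` one has `(1 + ε')/(1 − 7ε') = 1 + ε`.

## References

* E. Bombieri, W. Gubler, *Heights in Diophantine Geometry* (2006), Ex. 12.5.10 (the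
  normalisation `a ≡ 1 (mod 4)`, `16 ∣ b`). [BombieriGubler2006]
* J. Oesterlé, *Nouvelles approches du «théorème» de Fermat*, Sém. Bourbaki 694 (1988), §1
  (abc triples). [Oesterle1988]
-/

noncomputable section

open UniqueFactorizationMonoid

namespace Literature.NumberTheory.DiophantineGeometry

/-! ### Arithmetic of the auxiliary triple `(u⁸, v⁸ − u⁸, v⁸)` -/

/-- An odd eighth power is `1 (mod 16)` (indeed `(mod 32)`). [folklore] -/
theorem pow_eight_mod_sixteen_of_odd {u : ℕ} (hu : Odd u) : u ^ 8 % 16 = 1 := by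
  have h : u % 16 < 16 := Nat.mod_lt _ (by norm_num)
  have hodd : (u % 16) % 2 = 1 := by
    rw [Nat.mod_mod_of_dvd _ (by norm_num : 2 ∣ 16)]; exact Nat.odd_iff.mp hu
  rw [Nat.pow_mod]
  interval_cases hr : u % 16 <;> (norm_num at hodd <;> norm_num)

/-- For odd `u ≤ v`, `16 ∣ v⁸ − u⁸`. [folklore] -/
theorem sixteen_dvd_pow_eight_sub {u v : ℕ} (hu : Odd u) (hv : Odd v) (huv : u ≤ v) :
    16 ∣ v ^ 8 - u ^ 8 :=
  (Nat.modEq_iff_dvd' (Nat.pow_le_pow_left huv 8)).mp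
    ((pow_eight_mod_sixteen_of_odd hu).trans (pow_eight_mod_sixteen_of_odd hv).symm)

/-- **The auxiliary triple.** For coprime odd `u < v` and `w` coprime to `uv` with
`v⁸ − u⁸ = w · Q`, `Q ≤ 8 v⁷`: `(u⁸, v⁸ − u⁸, v⁸)` is an abc triple with `16 ∣` the product of
its members and `rad(u⁸ (v⁸ − u⁸) v⁸) ≤ 8 v⁷ · rad(uvw)`. [folklore] -/
theorem isABCTriple_pow_eight {u v w Q : ℕ} (huv : u < v) (hu : Odd u) (hv : Odd v)
    (hcop : Nat.Coprime u v) (hcopw : Nat.Coprime (u * v) w) (hQ : v ^ 8 - u ^ 8 = w * Q)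
    (hQle : Q ≤ 8 * v ^ 7) :
    IsABCTriple (u ^ 8) (v ^ 8 - u ^ 8) (v ^ 8) ∧ 16 ∣ u ^ 8 * (v ^ 8 - u ^ 8) * v ^ 8 ∧
      rad (u ^ 8) (v ^ 8 - u ^ 8) (v ^ 8) ≤ 8 * v ^ 7 * radical (u * v * w) := by
  have hu0 : 0 < u := hu.pos
  have hv0 : 0 < v := hv.pos
  have hlt : u ^ 8 < v ^ 8 := Nat.pow_lt_pow_left huv (by norm_num)
  have hsub0 : 0 < v ^ 8 - u ^ 8 := Nat.sub_pos_of_lt hlt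
  have hQ0 : Q ≠ 0 := by
    rintro rfl
    rw [mul_zero] at hQ
    omega
  refine ⟨⟨pow_pos hu0 8, hsub0, Nat.add_sub_cancel' hlt.le, ?_⟩, ?_, ?_⟩
  · exact (Nat.coprime_sub_self_right hlt.le).mpr (Nat.Coprime.pow 8 8 hcop)
  · exact dvd_mul_of_dvd_left (dvd_mul_of_dvd_right (sixteen_dvd_pow_eight_sub hu hv huv.le) _) _
  · -- radicals
    rw [rad_def, hQ]
    have h1 : radical (u ^ 8 * (w * Q) * v ^ 8) ∣ radical (u ^ 8) * radical (w * Q) * radical (v ^ 8) :=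
      (radical_mul_dvd).trans (mul_dvd_mul radical_mul_dvd dvd_rfl)
    rw [radical_pow u (by norm_num), radical_pow v (by norm_num)] at h1
    have h2 : radical (w * Q) ∣ radical w * Q :=
      radical_mul_dvd.trans (mul_dvd_mul_left _ radical_dvd_self)
    have h3 : radical (u ^ 8 * (w * Q) * v ^ 8) ∣ Q * (radical u * radical v * radical w) := by
      refine h1.trans ?_
      calc radical u * radical (w * Q) * radical v ∣ radical u * (radical w * Q) * radical v :=
            mul_dvd_mul (mul_dvd_mul_left _ h2) dvd_rfl
        _ = Q * (radical u * radical v * radical w) := by ring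
    have hprod : radical u * radical v * radical w = radical (u * v * w) := by
      rw [← radical_mul (Nat.coprime_iff_isRelPrime.mp hcop),
        ← radical_mul (Nat.coprime_iff_isRelPrime.mp hcopw)]
    rw [hprod] at h3
    have hpos : 0 < Q * radical (u * v * w) :=
      Nat.mul_pos (Nat.pos_of_ne_zero hQ0) (Nat.pos_of_ne_zero radical_ne_zero)
    calc radical (u ^ 8 * (w * Q) * v ^ 8) ≤ Q * radical (u * v * w) := Nat.le_of_dvd hpos h3
      _ ≤ 8 * v ^ 7 * radical (u * v * w) := Nat.mul_le_mul_right _ hQle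

/-! ### The real-variable step -/

/-- From `v⁸ ≤ K (8 v⁷ R)^{1+ε'}` with `7ε' < 1`, `K ≥ 0`, `v > 0`, `R ≥ 1`:
`v ≤ (K 8^{1+ε'})^{1/(1−7ε')} · R^{(1+ε')/(1−7ε')}`. [folklore] -/
theorem le_of_pow_eight_le {v K R ε' : ℝ} (hv : 0 < v) (hK : 0 ≤ K) (hR : 1 ≤ R)
    (h7 : 7 * ε' < 1) (h : v ^ 8 ≤ K * (8 * v ^ 7 * R) ^ (1 + ε')) :
    v ≤ (K * 8 ^ (1 + ε')) ^ (1 / (1 - 7 * ε')) * R ^ ((1 + ε') / (1 - 7 * ε')) := by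
  have hR0 : 0 ≤ R := zero_le_one.trans hR
  have he : 0 < 1 - 7 * ε' := by linarith
  -- expand the right-hand side
  have h1 : (8 * v ^ 7 * R) ^ (1 + ε') = 8 ^ (1 + ε') * v ^ (7 * (1 + ε')) * R ^ (1 + ε') := by
    rw [Real.mul_rpow (by positivity) hR0, Real.mul_rpow (by norm_num) (by positivity),
      ← Real.rpow_natCast v 7, ← Real.rpow_mul hv.le]
    norm_num
  rw [h1] at h
  -- `v⁸ = v^{1-7ε'} · v^{7(1+ε')}`
  have h2 : v ^ 8 = v ^ (1 - 7 * ε') * v ^ (7 * (1 + ε')) := by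
    rw [← Real.rpow_add hv, ← Real.rpow_natCast v 8]
    congr 1; push_cast; ring
  have hpow : 0 < v ^ (7 * (1 + ε')) := Real.rpow_pos_of_pos hv _
  have h3 : v ^ (1 - 7 * ε') ≤ K * 8 ^ (1 + ε') * R ^ (1 + ε') := by
    refine le_of_mul_le_mul_right ?_ hpow
    calc v ^ (1 - 7 * ε') * v ^ (7 * (1 + ε')) = v ^ 8 := h2.symm
      _ ≤ K * (8 ^ (1 + ε') * v ^ (7 * (1 + ε')) * R ^ (1 + ε')) := h
      _ = K * 8 ^ (1 + ε') * R ^ (1 + ε') * v ^ (7 * (1 + ε')) := by ring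
  -- take `1/(1-7ε')`-th powers
  have h4 := Real.rpow_le_rpow (Real.rpow_nonneg hv.le _) h3 (one_div_pos.mpr he).le
  rw [← Real.rpow_mul hv.le, mul_one_div_cancel he.ne', Real.rpow_one,
    Real.mul_rpow (by positivity) (Real.rpow_nonneg hR0 _), ← Real.rpow_mul hR0,
    mul_one_div] at h4
  exact h4

/-! ### The reduction -/

/-- **abc for triples with `16 ∣ abc` implies abc.** If for every `ε > 0` there is `C` such that
`c ≤ C · rad(abc)^{1+ε}` for all abc triples `(a, b, c)` with `16 ∣ abc`, then for every `ε > 0`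
there is `C` such that `c ≤ C · rad(abc)^{1+ε}` for all abc triples (via the auxiliary triple
`(u⁸, v⁸ − u⁸, v⁸)` on the two odd members `u < v`, module docstring). [folklore] -/
theorem abcLe_of_abcLe_sixteen_dvd
    (h : ∀ ε : ℝ, 0 < ε → ∃ C : ℝ, ∀ a b c : ℕ, IsABCTriple a b c → 16 ∣ a * b * c →
      (c : ℝ) ≤ C * ((rad a b c : ℕ) : ℝ) ^ (1 + ε)) :
    ∀ ε : ℝ, 0 < ε → ∃ C : ℝ, ∀ a b c : ℕ, IsABCTriple a b c →
      (c : ℝ) ≤ C * ((rad a b c : ℕ) : ℝ) ^ (1 + ε) := by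
  intro ε hε
  -- exponents
  set ε' : ℝ := ε / (8 + 7 * ε) with hε'def
  have hε' : 0 < ε' := by positivity
  have h7 : 7 * ε' < 1 := by
    rw [hε'def, ← lt_div_iff₀' (by norm_num : (0 : ℝ) < 7), div_lt_iff₀ (by positivity)]
    linarith
  have hexp : (1 + ε') / (1 - 7 * ε') = 1 + ε := by
    have h87 : (8 + 7 * ε) ≠ 0 := by positivity
    rw [div_eq_iff (by linarith), hε'def]
    field_simp
    ring
  -- constants
  obtain ⟨C₁, hC₁⟩ := h ε hε
  obtain ⟨C₂, hC₂⟩ := h ε' hε'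
  set K : ℝ := max C₂ 0 with hKdef
  have hK : 0 ≤ K := le_max_right _ _
  set Kf : ℝ := 2 * (K * 8 ^ (1 + ε')) ^ (1 / (1 - 7 * ε')) with hKf
  have hKf0 : 0 ≤ Kf := by positivity
  set C : ℝ := max (max C₁ 2) Kf with hCdef
  refine ⟨C, fun a b c habc ↦ ?_⟩
  set R : ℝ := ((rad a b c : ℕ) : ℝ) with hRdef
  have hRpos : 0 < rad a b c := by rw [rad_def]; exact Nat.pos_of_ne_zero radical_ne_zero
  have hR : (1 : ℝ) ≤ R := by rw [hRdef]; exact_mod_cast hRpos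
  have hR0 : (0 : ℝ) ≤ R ^ (1 + ε) := by positivity
  have hRge : (1 : ℝ) ≤ R ^ (1 + ε) := Real.one_le_rpow hR (by linarith)
  by_cases h16 : 16 ∣ a * b * c
  · calc (c : ℝ) ≤ C₁ * R ^ (1 + ε) := hC₁ a b c habc h16
      _ ≤ C * R ^ (1 + ε) :=
        mul_le_mul_of_nonneg_right ((le_max_left _ _).trans (le_max_left _ _)) hR0
  -- `16 ∤ abc`: the generic step, for a suitable choice of `(u, v, w)`
  have key : ∀ u v w Q : ℕ, u < v → Odd u → Odd v → Nat.Coprime u v →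
      Nat.Coprime (u * v) w → v ^ 8 - u ^ 8 = w * Q → Q ≤ 8 * v ^ 7 →
      u * v * w = a * b * c → c ≤ 2 * v → (c : ℝ) ≤ C * R ^ (1 + ε) := by
    intro u v w Q huv hu hv hcop hcopw hQ hQle hperm hc2
    obtain ⟨hT, h16', hrad⟩ := isABCTriple_pow_eight huv hu hv hcop hcopw hQ hQle
    have hv0 : (0 : ℝ) < v := by exact_mod_cast hv.pos
    have hb := hC₂ _ _ _ hT h16'
    -- `rad' ≤ 8 v⁷ R`
    have hradR : radical (u * v * w) = rad a b c := by rw [rad_def, hperm]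
    have hrad' : ((rad (u ^ 8) (v ^ 8 - u ^ 8) (v ^ 8) : ℕ) : ℝ) ≤ 8 * (v : ℝ) ^ 7 * R := by
      rw [hRdef, ← hradR]; exact_mod_cast hrad
    have hb' : (v : ℝ) ^ 8 ≤ K * (8 * (v : ℝ) ^ 7 * R) ^ (1 + ε') := by
      have hcast : (((v ^ 8 : ℕ) : ℕ) : ℝ) = (v : ℝ) ^ 8 := by push_cast; ring
      rw [← hcast]
      calc (((v ^ 8 : ℕ) : ℕ) : ℝ) ≤ C₂ * ((rad (u ^ 8) (v ^ 8 - u ^ 8) (v ^ 8) : ℕ) : ℝ) ^ (1 + ε') := hb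
        _ ≤ K * ((rad (u ^ 8) (v ^ 8 - u ^ 8) (v ^ 8) : ℕ) : ℝ) ^ (1 + ε') :=
          mul_le_mul_of_nonneg_right (le_max_left _ _) (by positivity)
        _ ≤ K * (8 * (v : ℝ) ^ 7 * R) ^ (1 + ε') :=
          mul_le_mul_of_nonneg_left (Real.rpow_le_rpow (by positivity) hrad' (by linarith)) hK
    have hvle := le_of_pow_eight_le hv0 hK hR h7 hb'
    rw [hexp] at hvle
    calc (c : ℝ) ≤ 2 * (v : ℝ) := by exact_mod_cast hc2
      _ ≤ 2 * ((K * 8 ^ (1 + ε')) ^ (1 / (1 - 7 * ε')) * R ^ (1 + ε)) := by linarith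
      _ = Kf * R ^ (1 + ε) := by rw [hKf]; ring
      _ ≤ C * R ^ (1 + ε) := mul_le_mul_of_nonneg_right (le_max_right _ _) hR0
  -- parity analysis
  obtain ⟨ha, hb, habc, hcop⟩ := habc
  have hac : Nat.Coprime a c := by rw [← habc]; exact Nat.coprime_self_add_right.mpr hcop
  have hbc : Nat.Coprime b c := by rw [← habc]; exact Nat.coprime_add_self_right.mpr hcop.symm
  rcases Nat.even_or_odd a with ha2 | ha2 <;> rcases Nat.even_or_odd b with hb2 | hb2
  · -- both even: impossible
    exfalso
    have := Nat.dvd_gcd (even_iff_two_dvd.mp ha2) (even_iff_two_dvd.mp hb2)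
    rw [hcop.gcd_eq_one] at this
    omega
  · -- `a` even, `b` odd, `c` odd: `(u, v, w) = (b, c, a)`
    have hc2 : Odd c := by rw [← habc]; exact ha2.add_odd hb2
    have hbc' : b < c := by omega
    refine key b c a ((c + b) * (c ^ 2 + b ^ 2) * (c ^ 4 + b ^ 4)) hbc' hb2 hc2 hbc
      (Nat.Coprime.mul_left hcop.symm hac.symm) ?_ ?_ (by rw [← habc]; ring) (by omega)
    · have hle : b ^ 8 ≤ c ^ 8 := Nat.pow_le_pow_left hbc'.le 8
      have hca : c - b = a := by omega
      zify [hle, hbc'.le] at hca ⊢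
      rw [← hca]; ring
    · have h1 : c + b ≤ 2 * c := by omega
      have h2 : c ^ 2 + b ^ 2 ≤ 2 * c ^ 2 := by nlinarith
      have h3 : c ^ 4 + b ^ 4 ≤ 2 * c ^ 4 := by
        have := Nat.pow_le_pow_left hbc'.le 4; omega
      calc (c + b) * (c ^ 2 + b ^ 2) * (c ^ 4 + b ^ 4) ≤ (2 * c) * (2 * c ^ 2) * (2 * c ^ 4) :=
            Nat.mul_le_mul (Nat.mul_le_mul h1 h2) h3
        _ = 8 * c ^ 7 := by ring
  · -- `a` odd, `b` even, `c` odd: `(u, v, w) = (a, c, b)`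
    have hc2 : Odd c := by rw [← habc]; exact ha2.add_even hb2
    have hac' : a < c := by omega
    refine key a c b ((c + a) * (c ^ 2 + a ^ 2) * (c ^ 4 + a ^ 4)) hac' ha2 hc2 hac
      (Nat.Coprime.mul_left hcop hbc.symm) ?_ ?_ (by rw [← habc]; ring) (by omega)
    · have hle : a ^ 8 ≤ c ^ 8 := Nat.pow_le_pow_left hac'.le 8
      have hcb : c - a = b := by omega
      zify [hle, hac'.le] at hcb ⊢
      rw [← hcb]; ring
    · have h1 : c + a ≤ 2 * c := by omega
      have h2 : c ^ 2 + a ^ 2 ≤ 2 * c ^ 2 := by nlinarith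
      have h3 : c ^ 4 + a ^ 4 ≤ 2 * c ^ 4 := by
        have := Nat.pow_le_pow_left hac'.le 4; omega
      calc (c + a) * (c ^ 2 + a ^ 2) * (c ^ 4 + a ^ 4) ≤ (2 * c) * (2 * c ^ 2) * (2 * c ^ 4) :=
            Nat.mul_le_mul (Nat.mul_le_mul h1 h2) h3
        _ = 8 * c ^ 7 := by ring
  · -- both odd, `c` even
    rcases lt_trichotomy a b with hab | hab | hab
    · -- `(u, v, w) = (a, b, c)`
      refine key a b c ((b - a) * (b ^ 2 + a ^ 2) * (b ^ 4 + a ^ 4)) hab ha2 hb2 hcop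
        (Nat.Coprime.mul_left hac hbc) ?_ ?_ rfl (by omega)
      · have hle : a ^ 8 ≤ b ^ 8 := Nat.pow_le_pow_left hab.le 8
        zify [hle, hab.le]
        rw [← habc]; push_cast; ring
      · have h1 : b - a ≤ 2 * b := by omega
        have h2 : b ^ 2 + a ^ 2 ≤ 2 * b ^ 2 := by nlinarith
        have h3 : b ^ 4 + a ^ 4 ≤ 2 * b ^ 4 := by
          have := Nat.pow_le_pow_left hab.le 4; omega
        calc (b - a) * (b ^ 2 + a ^ 2) * (b ^ 4 + a ^ 4) ≤ (2 * b) * (2 * b ^ 2) * (2 * b ^ 4) :=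
              Nat.mul_le_mul (Nat.mul_le_mul h1 h2) h3
          _ = 8 * b ^ 7 := by ring
    · -- `a = b`: then `a = b = 1`, `c = 2`
      subst hab
      have ha1 : a = 1 := by simpa using hcop
      subst ha1
      have hc : c = 2 := by omega
      subst hc
      calc ((2 : ℕ) : ℝ) = 2 * 1 := by norm_num
        _ ≤ C * R ^ (1 + ε) :=
          mul_le_mul ((le_max_right _ _).trans (le_max_left _ _)) hRge zero_le_one
            (le_trans (by norm_num) ((le_max_right _ _).trans (le_max_left _ _)))
    · -- `(u, v, w) = (b, a, c)`
      refine key b a c ((a - b) * (a ^ 2 + b ^ 2) * (a ^ 4 + b ^ 4)) hab hb2 ha2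
        hcop.symm (Nat.Coprime.mul_left hbc hac) ?_ ?_ (by ring) (by omega)
      · have hle : b ^ 8 ≤ a ^ 8 := Nat.pow_le_pow_left hab.le 8
        zify [hle, hab.le]
        rw [← habc]; push_cast; ring
      · have h1 : a - b ≤ 2 * a := by omega
        have h2 : a ^ 2 + b ^ 2 ≤ 2 * a ^ 2 := by nlinarith
        have h3 : a ^ 4 + b ^ 4 ≤ 2 * a ^ 4 := by
          have := Nat.pow_le_pow_left hab.le 4; omega
        calc (a - b) * (a ^ 2 + b ^ 2) * (a ^ 4 + b ^ 4) ≤ (2 * a) * (2 * a ^ 2) * (2 * a ^ 4) :=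
              Nat.mul_le_mul (Nat.mul_le_mul h1 h2) h3
          _ = 8 * a ^ 7 := by ring

end Literature.NumberTheory.DiophantineGeometry

end
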